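import Literature.MathematicalPhysics.QuantumFieldTheory.Balaban1983to89.B5G183RateW1RankOne
import Literature.MathematicalPhysics.QuantumFieldTheory.Balaban1983to89.B5G183RateObstructionOp

/-!
# Bałaban [CMP 95 (1984)] (1.89) at `U = 1`, order two: the EXPONENT-TRADE residual TYPED —
weights `W^θ` on each derivative, rate `N^{−γ}`; the two endpoints are kernel facts

HONEST FRAMING (cell `pub-balaban`, T⁴ programme, estimate NE2 = U1a «η-rate, linear theory»).  Finite
torus, `η = 1/n`, `U = 1`, one nonzero reduced momentum `p′ = s` at a time, `ℓ²`-operator norm on the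
alias classes `× Fin d`.  Nothing here is about infinite volume, `U ≠ 1`, a mass gap, or any summit
statement.  Print states NO rate; the currency, King's pairing and every constant are OURS ([folklore]).

WHAT IS PRINTED.  [Balaban1984PropagatorsI] p. 33: «Proposition 1.1. The operator G is a symmetric
operator on L²(T_η) and ‖GJ‖, ‖∇GJ‖, ‖G∇*J‖, ‖∇G∇*J‖, ‖∇∇GJ‖, ‖G∇*∇*J‖ ≤ γ₀⁻¹‖J‖, (1.89)».  [King1986]
p. 672 (4.20) `|u(p′+l)| ≤ Π_μ|p′_μ||p′_μ+l_μ|⁻¹`, (4.22) «≤ C for α < 1.», (4.23) «≤ CL^{−γk} for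
α + γ < 1»; p. 673: «So keeping γ + α < 1, the error produced by the above replacement is bounded by
CL^{−γk}.»  (renders ref1 p017, king p024/p025 read as images by this seat.)

WHAT THIS MODULE DOES (kernel, [folklore]).  It TYPES the one remaining order-two question at `U = 1`
fibrewise — King's exponent trade in our bookkeeping — and records its two decided endpoints:
 * `wθdSym n θ k s ν := (W_k)^θ · ∂^{(n)}_ν(q̃_k)` (real power of King's alias weight `Wc ∈ [0,1]`);
   `wθdSym_zero` (`θ = 0`: the bare derivative), `wθdSym_one` (`θ = 1`: `B5G183RateO2Op.w1dSym`);
 * **`OrderTwoOpRateResidualWθ d a C θ γ : Prop`** — the planted difference of the sandwiches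
   `D_{W^θ∂ν} G D*_{W^θ∂ν′}` between the levels `N` and `RN` is `≤ C/N^γ` for all `N, R ≥ 1`, `p′ ≠ 0`,
   `ν, ν′`.  It is NOT proved here for `0 < θ < 1` and it is NOT a hypothesis of any theorem;
 * endpoints: **`orderTwoOpRateResidualWθ_one_holds`** (`θ = 1, γ = 1` TRUE with `C = CW1op d a` —
   `B5G183RateW1RankOne.orderTwoOpRateResidualW1_holds`), **`not_orderTwoOpRateResidualWθ_zero`**
   (`θ = 0, γ = 1` FALSE for every `C` when `d ≥ 2` — `B5G183RateObstructionOp.not_orderTwoOpRateResidual`),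
   and `orderTwoOpRateResidualWθ_mono` (γ′ ≤ γ).
FOR THE SUCCESSOR ([analysis]; the expected exponent is `γ(θ) = θ`, by interpolating the derivative
replacement cost `6|q̃|²/N` with its uniform bound): decide `∃ C, OrderTwoOpRateResidualWθ d a C θ θ` for
`0 < θ < 1`, and the sharpness in `γ`.

NOT CLAIMED: any rate for `0 < θ < 1`; `p′`-derivatives; the `∫dp′` identification; Prop. 1.2 decay
with rate; `U ≠ 1`; constants.
-/

noncomputable section

namespace Literature.MathematicalPhysics.QuantumFieldTheory.Balaban1983to89.B5G183RateWTheta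

open scoped BigOperators ComplexConjugate Matrix.Norms.L2Operator
open Finset Complex
open Literature.MathematicalPhysics.QuantumFieldTheory.Balaban1983to89.B4Strip
open Literature.MathematicalPhysics.QuantumFieldTheory.Balaban1983to89.B5Prop11Fiber
open Literature.MathematicalPhysics.QuantumFieldTheory.Balaban1983to89.B5Prop11Bound
open Literature.MathematicalPhysics.QuantumFieldTheory.Balaban1983to89.B5Hk163Rate
open Literature.MathematicalPhysics.QuantumFieldTheory.Balaban1983to89.B5Hk163RateSum
open Literature.MathematicalPhysics.QuantumFieldTheory.Balaban1983to89.B5G183RateOp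
open Literature.MathematicalPhysics.QuantumFieldTheory.Balaban1983to89.B5G183RateObstructionOp
open Literature.MathematicalPhysics.QuantumFieldTheory.Balaban1983to89.B5G183RateO2Diag
open Literature.MathematicalPhysics.QuantumFieldTheory.Balaban1983to89.B5G183RateO2Op
open Literature.MathematicalPhysics.QuantumFieldTheory.Balaban1983to89.B5G183RateW1RankOne
open Literature.MathematicalPhysics.QuantumFieldTheory.King1986

variable {d : ℕ}

/-! ## §1 The interpolating weight [folklore] -/

section Weight

variable {n : ℕ} [NeZero n]

/-- `(W_k)^θ · ∂^{(n)}_ν(q̃_k)`: King's alias weight to a REAL power `θ` on one lattice derivative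
(`θ = 1` is King's `u … ū` placement (4.19), `θ = 0` the bare derivative). [cite: King1986, (4.19)–(4.20)
p.672] [folklore] -/
def wθdSym (n : ℕ) [NeZero n] (θ : ℝ) (k : Fin d → Fin n) (s : Fin d → ℝ) (ν : Fin d) : ℂ :=
  ((Wc n k s ^ θ : ℝ) : ℂ) * dSym n k s ν

/-- `θ = 0`: the bare derivative symbol. [folklore] -/
@[simp] theorem wθdSym_zero (k : Fin d → Fin n) (s : Fin d → ℝ) (ν : Fin d) :
    wθdSym n 0 k s ν = dSym n k s ν := by
  unfold wθdSym; rw [Real.rpow_zero]; push_cast; ring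

/-- `θ = 1`: `B5G183RateO2Op.w1dSym`. [folklore] -/
@[simp] theorem wθdSym_one (k : Fin d → Fin n) (s : Fin d → ℝ) (ν : Fin d) :
    wθdSym n 1 k s ν = w1dSym n k s ν := by
  unfold wθdSym w1dSym; rw [Real.rpow_one]

/-- `|W^θ ∂| ≤ |∂|` for `θ ≥ 0` (`0 ≤ W ≤ 1`). [folklore] -/
theorem norm_wθdSym_le {θ : ℝ} (hθ : 0 ≤ θ) (k : Fin d → Fin n) {s : Fin d → ℝ}
    (hs : ∀ ν, |s ν| ≤ Real.pi) (ν : Fin d) : ‖wθdSym n θ k s ν‖ ≤ ‖dSym n k s ν‖ := by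
  have hW := Wc_nonneg_le_one (n := n) k hs
  have h1 : Wc n k s ^ θ ≤ 1 := Real.rpow_le_one hW.1 hW.2 hθ
  have h0 : 0 ≤ Wc n k s ^ θ := Real.rpow_nonneg hW.1 θ
  unfold wθdSym
  rw [norm_mul, Complex.norm_real, Real.norm_eq_abs, abs_of_nonneg h0]
  exact mul_le_of_le_one_left (norm_nonneg _) h1

end Weight

/-! ## §2 The exponent-trade residual, typed; endpoints [folklore] -/

section Residual

/-- **THE EXPONENT-TRADE RESIDUAL (TYPED; NOT proved for `0 < θ < 1`, NOT a hypothesis anywhere):**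
for all `N, R ≥ 1`, `p′ ≠ 0`, `ν, ν′`,
`‖D_{W^θ∂^{(RN)}_ν} F_{RN} D*_{W^θ∂^{(RN)}_{ν′}} − plant_R(D_{W^θ∂^{(N)}_ν} F_N D*_{W^θ∂^{(N)}_{ν′}})‖ ≤ C/N^γ`.
Known: `θ = 1 ⇒ γ = 1` (`orderTwoOpRateResidualWθ_one_holds`), `θ = 0 ⇒` no `γ = 1` rate
(`not_orderTwoOpRateResidualWθ_zero`); expected for `0 < θ < 1` [analysis]: `γ(θ) = θ` (King: «keeping γ + α < 1»).
[cite: Balaban1984PropagatorsI, Prop. 1.1 (1.89) p.33; King1986, (4.22)–(4.23) p.672, (4.24) p.673] [folklore] -/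
def OrderTwoOpRateResidualWθ (d : ℕ) (a C θ γ : ℝ) : Prop :=
  ∀ (N R : ℕ) [NeZero N] [NeZero R] (hN : 1 ≤ N) (hRN : 1 ≤ R * N) (ha : 0 < a) (s : Fin d → ℝ)
    (hs : ∀ ν, |s ν| ≤ Real.pi) (hs0 : s ≠ 0) (ν ν' : Fin d), 1 ≤ R →
    ‖sandwich (fun K => wθdSym (R * N) θ K s ν) (fun K => wθdSym (R * N) θ K s ν')
          (balabanFiber (R * N) hRN a ha s hs hs0).G
        - plant R s (sandwich (fun k => wθdSym N θ k s ν) (fun k => wθdSym N θ k s ν')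
          (balabanFiber N hN a ha s hs hs0).G)‖
      ≤ C / (N : ℝ) ^ γ

/-- `θ = 1` IS the `W∂ ⊗ W∂` residual of `B5G183RateO2Op`. [folklore] -/
theorem orderTwoOpRateResidualWθ_one_iff (d : ℕ) (a C γ : ℝ) :
    OrderTwoOpRateResidualWθ d a C 1 γ ↔ OrderTwoOpRateResidualW1 d a C γ := by
  unfold OrderTwoOpRateResidualWθ OrderTwoOpRateResidualW1
  simp only [wθdSym_one]

/-- `θ = 0, γ = 1` IS the unweighted residual of `B5G183RateObstructionOp`. [folklore] -/
theorem orderTwoOpRateResidualWθ_zero_iff (d : ℕ) (a C : ℝ) :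
    OrderTwoOpRateResidualWθ d a C 0 1 ↔ OrderTwoOpRateResidual d a C := by
  unfold OrderTwoOpRateResidualWθ OrderTwoOpRateResidual
  simp only [wθdSym_zero, Real.rpow_one]

/-- **ENDPOINT `θ = 1`: TRUE with the full rate** (`B5G183RateW1RankOne.orderTwoOpRateResidualW1_holds`).
[cite: Balaban1984PropagatorsI, Prop. 1.1 (1.89) p.33; King1986, (4.19)–(4.20) p.672] [folklore] -/
theorem orderTwoOpRateResidualWθ_one_holds (d : ℕ) (a : ℝ) :
    OrderTwoOpRateResidualWθ d a (CW1op d a) 1 1 :=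
  (orderTwoOpRateResidualWθ_one_iff d a _ 1).mpr (orderTwoOpRateResidualW1_holds d a)

/-- **ENDPOINT `θ = 0`: FALSE at `γ = 1` for every constant** (`d ≥ 2`, witnessed by two distinct
directions; `B5G183RateObstructionOp.not_orderTwoOpRateResidual`). [cite: Balaban1984PropagatorsI,
Prop. 1.1 (1.89) p.33; King1986, (4.22)–(4.23) p.672] [folklore] -/
theorem not_orderTwoOpRateResidualWθ_zero {μ₁ μ₂ : Fin d} (hne : μ₁ ≠ μ₂) (a : ℝ) (ha : 0 < a)
    (C : ℝ) : ¬ OrderTwoOpRateResidualWθ d a C 0 1 := fun h =>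
  not_orderTwoOpRateResidual hne a ha C ((orderTwoOpRateResidualWθ_zero_iff d a C).mp h)

/-- monotone in the exponent: a rate `N^{−γ}` gives every `N^{−γ′}`, `γ′ ≤ γ` (`N ≥ 1`). [folklore] -/
theorem orderTwoOpRateResidualWθ_mono {d : ℕ} {a C θ γ γ' : ℝ} (hC : 0 ≤ C) (hγ : γ' ≤ γ)
    (h : OrderTwoOpRateResidualWθ d a C θ γ) : OrderTwoOpRateResidualWθ d a C θ γ' := by
  intro N R _ _ hN hRN ha s hs hs0 ν ν' hR
  have hN1 : (1 : ℝ) ≤ N := by exact_mod_cast hN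
  calc _ ≤ C / (N : ℝ) ^ γ := h N R hN hRN ha s hs hs0 ν ν' hR
    _ ≤ C / (N : ℝ) ^ γ' := by
        apply div_le_div_of_nonneg_left hC (Real.rpow_pos_of_pos (by linarith) _)
        exact Real.rpow_le_rpow_of_exponent_le hN1 hγ

/-- the DICHOTOMY of the endpoints in one statement (`d ≥ 2`): with one full King weight per derivative
the order-two eta-rate is `1/N`; with none there is no `1/N` rate. [folklore] -/
theorem endpoints {μ₁ μ₂ : Fin d} (hne : μ₁ ≠ μ₂) (a : ℝ) (ha : 0 < a) :
    OrderTwoOpRateResidualWθ d a (CW1op d a) 1 1 ∧ ∀ C, ¬ OrderTwoOpRateResidualWθ d a C 0 1 :=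
  ⟨orderTwoOpRateResidualWθ_one_holds d a, fun C => not_orderTwoOpRateResidualWθ_zero hne a ha C⟩

end Residual

end Literature.MathematicalPhysics.QuantumFieldTheory.Balaban1983to89.B5G183RateWTheta
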